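import Literature.AlgebraicGeometry.Frobenioids.FiberProducts
import Literature.AlgebraicGeometry.Frobenioids.ModelFrobenioidFunctor
import HarnessLib

/-!
# Frobenioids I, Prop. 1.6 × Thm. 5.2 (i): the fibre product `C ×_D D′` of a MODEL Frobenioid along `D′ → D` IS the
# model Frobenioid of the pulled-back data `(Φ|_{D′}, B|_{D′}, Div_B|_{D′})` — an equivalence commuting ON THE NOSE
# with the structure functors to `F_{Φ|_{D′}}` and with the projections to `D′`

S. Mochizuki, *The geometry of Frobenioids I: the general theory*, Kyushu J. Math. **62** (2008) 293–400, Prop. 1.6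
p. 27 ("`C′ := C ×_D D′` … the natural functor `C′ → F_{Φ′}`", `Φ′ := Φ|_{D′}`) [cite: MochizukiFrdI2008, Prop. 1.6 p.27]
and Thm. 5.2 (i) p. 100 (the model Frobenioid of `(Φ, B, Div_B)`: objects `(A_D, α ∈ Φ(A_D)^gp)`, arrows
`(deg_Fr, Base, Div, u)` subject to `deg_Fr·α + Div = Base^*β + Div_B(u)`) [cite: MochizukiFrdI2008, Thm. 5.2(i) p.100].

PROOF-ONLY file (cell abc-iut; seat abc-iut-w4-d109; L1 brick for the [IUTchI] Ex. 5.1 (iii) restriction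
`†ℱ^⊚ := †ℱ^⊛|_{†𝒟^⊚} = †ℱ^⊛ ×_{†𝒟^⊛} †𝒟^⊚` of the global model Frobenioid, "the `⊚`-twin" of [FrdI] Cor. 4.11 at
`ℱ^⊛(†𝒟^⊚)`), 0 definitions.  For divisor data `(Φ, B, Div_B)` on `D` and ANY functor `T : D′ ⥤ D`, abc-iut-found's
categorical fibre product `PreFrobenioid.FiberProduct (toElem Φ B Div_B) T` (`FiberProducts.lean`, [FrdI] Prop. 1.6)
is EQUIVALENT to the model Frobenioid `ModelFrobenioid (T.op ⋙ Φ) (T.op ⋙ B) (Div_B ∘ T)` of the pulled-back data, by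
`((A_D, α), A′, e : A_D ≅ T A′) ↦ (A′, (e⁻¹)^* α)`, `(γ, γ′) ↦ (deg_Fr γ, γ′, (e⁻¹)^* Div γ, (e⁻¹)^* u_γ)` — and this
equivalence `E` satisfies, ON THE NOSE, `E ⋙ Base = pr₂` and `E ⋙ (C_{Φ′-model} → F_{Φ′}) = (C ×_D D′ → F_{Φ′})`
(abc-iut-found's `PreFrobenioid.fiberProductFunctor`).  Stated as an existential (`exists_fiberProduct_equivalence`)
so that the file declares no `def`; consumers transport [FrdI] Cor. 4.11's `1`-unique base squares and every
"`C ⥲ C′` over the same structure functor"-invariant property between the two presentations.  The element-level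
bookkeeping (relation (d) of Thm. 5.2 (i) moved along a base isomorphism) is isolated in §1 over abstract data.

Pure [FrdI] §0/§5 bookkeeping; no statement of the paper is restated or strengthened; nothing here bears on
[IUTchIII] Cor. 3.12.
-/

namespace Literature.AlgebraicGeometry.Frobenioids

open CategoryTheory Opposite

universe w v v' u u'

namespace ModelFrobenioid

variable {D : Type u} [Category.{v} D] {D' : Type u'} [Category.{v'} D']

/-! ### §1. Relation (d) of Thm. 5.2 (i) along a base isomorphism `e : A_D ≅ T A′` -/

section Transport

variable {Ψ : Dᵒᵖ ⥤ CommMonCat.{w}}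

/-- `(e⁻¹)^*` after `e^*` is the identity on `Ψ(−)`, `e` an isomorphism of the base. [folklore] -/
private theorem fpPull_inv_hom_cancel {A₀ A₁ : D} (e : A₀ ≅ A₁) (y : Ψ.obj (op A₁)) :
    pull Ψ e.inv (pull Ψ e.hom y) = y := by
  rw [← pull_comp, Iso.inv_hom_id, pull_id]

/-- `e^*` after `(e⁻¹)^*` is the identity on `Ψ(−)`, `e` an isomorphism of the base. [folklore] -/
private theorem fpPull_hom_inv_cancel {A₀ A₁ : D} (e : A₀ ≅ A₁) (x : Ψ.obj (op A₀)) :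
    pull Ψ e.hom (pull Ψ e.inv x) = x := by
  rw [← pull_comp, Iso.hom_inv_id, pull_id]

/-- `(e⁻¹)^*` is injective on `Ψ(−)`, `e` an isomorphism of the base. [folklore] -/
private theorem fpPull_inv_injective {A₀ A₁ : D} (e : A₀ ≅ A₁) : Function.Injective (pull Ψ e.inv) := fun x y h => by
  rw [← fpPull_hom_inv_cancel e x, h, fpPull_hom_inv_cancel]

/-- The square `b ∘ e₁ = e ∘ T γ′` of an arrow of the fibre product, inverted: `e⁻¹ ∘ b = T γ′ ∘ e₁⁻¹`.
[cite: MochizukiFrdI2008, Prop. 1.6 p.27] -/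
theorem inv_comp_eq_map_comp_inv (T : D' ⥤ D) {A₀ A₁ : D} {A' B' : D'} (e : A₀ ≅ T.obj A') (e₁ : A₁ ≅ T.obj B')
    (b : A₀ ⟶ A₁) (γ' : A' ⟶ B') (hw : b ≫ e₁.hom = e.hom ≫ T.map γ') : e.inv ≫ b = T.map γ' ≫ e₁.inv := by
  rw [Iso.inv_comp_eq, ← Category.assoc, Iso.eq_comp_inv]
  exact hw

/-- Transport of a "divisor of a composite" along base isomorphisms: `(e⁻¹)^*(b^* z · x^n) = (T γ′)^*((e₁⁻¹)^* z) ·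
((e⁻¹)^* x)^n` whenever `b ∘ e₁ = e ∘ T γ′` (the composition law of the fibre product, [FrdI] Prop. 1.6 (ii)).
[cite: MochizukiFrdI2008, Prop. 1.6 p.27] -/
theorem pull_inv_mul_pow_transport (T : D' ⥤ D) {A₀ A₁ : D} {A' B' : D'} (e : A₀ ≅ T.obj A')
    (e₁ : A₁ ≅ T.obj B') (b : A₀ ⟶ A₁) (γ' : A' ⟶ B') (hw : b ≫ e₁.hom = e.hom ≫ T.map γ')
    (z : Ψ.obj (op A₁)) (x : Ψ.obj (op A₀)) (n : ℕ) :
    pull Ψ e.inv (pull Ψ b z * x ^ n) = pull Ψ (T.map γ') (pull Ψ e₁.inv z) * pull Ψ e.inv x ^ n := by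
  rw [map_mul, map_pow, ← pull_comp, inv_comp_eq_map_comp_inv T e e₁ b γ' hw, pull_comp]

variable (Φ B : Dᵒᵖ ⥤ CommMonCat.{w}) (DivB : B ⟶ monoidGp Φ) (T : D' ⥤ D)

/-- **Relation (d) of [FrdI] Thm. 5.2 (i) transported along `e⁻¹`**: if `α^d · [z] = b^*β · Div_B(u)` in `Φ(A_D)^gp`
(the relation of an arrow `(d, b, z, u) : (A_D, α) → (B_D, β)`) and `b ∘ e₁ = e ∘ T γ′` for base isomorphisms
`e : A_D ≅ T A′`, `e₁ : B_D ≅ T B′`, then `((e⁻¹)^*α)^d · [(e⁻¹)^* z] = (T γ′)^*((e₁⁻¹)^*β) · Div_B((e⁻¹)^* u)` in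
`Φ(T A′)^gp` — the relation of `(d, γ′, (e⁻¹)^* z, (e⁻¹)^* u)` in the model Frobenioid of the pulled-back data.
[cite: MochizukiFrdI2008, Thm. 5.2(i) p.100] -/
theorem rel_transport_inv (A A₁ : ModelFrobenioid Φ B DivB) {A' B' : D'} (e : A.base ≅ T.obj A')
    (e₁ : A₁.base ≅ T.obj B') (b : A.base ⟶ A₁.base) (d : ℕ+) (z : Φ.obj (op A.base)) (u : B.obj (op A.base))
    (γ' : A' ⟶ B')
    (hrel : A.cls ^ (d : ℕ) * Algebra.GrothendieckGroup.of z = pullGp Φ b A₁.cls * divB Φ B DivB (op A.base) u)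
    (hw : b ≫ e₁.hom = e.hom ≫ T.map γ') :
    (pullGp Φ e.inv A.cls) ^ (d : ℕ) * Algebra.GrothendieckGroup.of (pull Φ e.inv z) =
      pullGp Φ (T.map γ') (pullGp Φ e₁.inv A₁.cls) * divB Φ B DivB (op (T.obj A')) (pull B e.inv u) := by
  have h := congrArg (pullGp Φ e.inv) hrel
  rw [map_mul, map_pow, pullGp_of, map_mul, pullGp_divB, ← pullGp_comp, inv_comp_eq_map_comp_inv T e e₁ b γ' hw,
    pullGp_comp] at h
  exact h

/-- **Relation (d) transported back along `e`**: from the relation `((e⁻¹)^*α)^d · [z] = (T b′)^*((e₁⁻¹)^*β) · Div_B(u)`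
of an arrow `(d, b′, z, u)` between the pulled-back objects one recovers the relation of the arrow
`(d, e ≫ T b′ ≫ e₁⁻¹, e^* z, e^* u) : (A_D, α) → (B_D, β)` of the original model Frobenioid.
[cite: MochizukiFrdI2008, Thm. 5.2(i) p.100] -/
theorem rel_transport_hom (A A₁ : ModelFrobenioid Φ B DivB) {A' B' : D'} (e : A.base ≅ T.obj A')
    (e₁ : A₁.base ≅ T.obj B') (b' : A' ⟶ B') (d : ℕ+) (z : Φ.obj (op (T.obj A'))) (u : B.obj (op (T.obj A')))
    (hrel : (pullGp Φ e.inv A.cls) ^ (d : ℕ) * Algebra.GrothendieckGroup.of z =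
      pullGp Φ (T.map b') (pullGp Φ e₁.inv A₁.cls) * divB Φ B DivB (op (T.obj A')) u) :
    A.cls ^ (d : ℕ) * Algebra.GrothendieckGroup.of (pull Φ e.hom z) =
      pullGp Φ ((e.hom ≫ T.map b') ≫ e₁.inv) A₁.cls * divB Φ B DivB (op A.base) (pull B e.hom u) := by
  have h := congrArg (pullGp Φ e.hom) hrel
  rw [map_mul, map_pow, ← pullGp_comp, Iso.hom_inv_id, pullGp_id, pullGp_of, map_mul, ← pullGp_comp,
    ← pullGp_comp, pullGp_divB] at h
  exact h

end Transport

/-! ### §2. The equivalence `(C_{(Φ,B,Div_B)}) ×_D D′ ≌ C_{(Φ|_{D′}, B|_{D′}, Div_B|_{D′})}` -/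

variable (Φ B : Dᵒᵖ ⥤ CommMonCat.{w}) (DivB : B ⟶ monoidGp Φ) (T : D' ⥤ D)

/-- **[FrdI] Prop. 1.6 × Thm. 5.2 (i): `(model Frobenioid of (Φ, B, Div_B)) ×_D D′ ≌ model Frobenioid of
(Φ|_{D′}, B|_{D′}, Div_B|_{D′})`**, an equivalence `E` commuting ON THE NOSE with the projections to `D′`
(`E ⋙ Base = pr₂`) and with the structure functors to the elementary Frobenioid `F_{Φ|_{D′}}`
(`E ⋙ toElem = fiberProductFunctor`).  On objects `((A_D, α), A′, e) ↦ (A′, (e⁻¹)^* α)`; on arrows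
`(γ, γ′) ↦ (deg_Fr γ, γ′, (e⁻¹)^* Div γ, (e⁻¹)^* u_γ)`; fully faithful (the `C`-component is recovered as
`(deg_Fr, e ≫ T γ′ ≫ e′⁻¹, e^* Div, e^* u)`) and essentially surjective (`(A′, α′)` is the image of
`((T A′, α′), A′, id)`). [cite: MochizukiFrdI2008, Prop. 1.6 p.27] -/
theorem exists_fiberProduct_equivalence :
    ∃ E : PreFrobenioid.FiberProduct (toElem Φ B DivB) T ≌
        ModelFrobenioid (T.op ⋙ Φ) (T.op ⋙ B) (Functor.whiskerLeft T.op DivB),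
      E.functor ⋙ baseFunctor (T.op ⋙ Φ) (T.op ⋙ B) (Functor.whiskerLeft T.op DivB) =
          CFP.proj₂ (PreFrobenioid.baseFunctor (toElem Φ B DivB)) T ∧
        E.functor ⋙ toElem (T.op ⋙ Φ) (T.op ⋙ B) (Functor.whiskerLeft T.op DivB) =
          PreFrobenioid.fiberProductFunctor (toElem Φ B DivB) T := by
  let Fwd : PreFrobenioid.FiberProduct (toElem Φ B DivB) T ⥤
      ModelFrobenioid (T.op ⋙ Φ) (T.op ⋙ B) (Functor.whiskerLeft T.op DivB) :=
    { obj := fun X => ⟨X.snd, pullGp Φ X.iso.inv X.fst.cls⟩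
      map := fun {X Y} f =>
        { degFr := degFr f.fst
          base := f.snd
          div := pull Φ X.iso.inv (div f.fst)
          unit := pull B X.iso.inv (unit f.fst)
          rel := rel_transport_inv Φ B DivB T X.fst Y.fst X.iso Y.iso (baseMap f.fst) (degFr f.fst) (div f.fst)
            (unit f.fst) f.snd (rel f.fst) f.w }
      map_id := fun X => by
        apply ModelFrobenioid.hom_ext
        · rfl
        · rfl
        · exact map_one (pull Φ X.iso.inv)
        · exact map_one (pull B X.iso.inv)
      map_comp := fun {X Y Z} f g => by
        apply ModelFrobenioid.hom_ext
        · rfl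
        · rfl
        · exact pull_inv_mul_pow_transport T X.iso Y.iso (baseMap f.fst) f.snd f.w (div g.fst) (div f.fst)
            (degFr g.fst : ℕ)
        · exact pull_inv_mul_pow_transport T X.iso Y.iso (baseMap f.fst) f.snd f.w (unit g.fst) (unit f.fst)
            (degFr g.fst : ℕ) }
  -- faithful
  haveI : Fwd.Faithful := ⟨fun {X Y} f g h => by
    have hd := congrArg ModelFrobenioid.degFr h
    have hb := congrArg ModelFrobenioid.baseMap h
    have hdiv := congrArg ModelFrobenioid.div h
    have hu := congrArg ModelFrobenioid.unit h
    change degFr f.fst = degFr g.fst at hd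
    change f.snd = g.snd at hb
    change pull Φ X.iso.inv (div f.fst) = pull Φ X.iso.inv (div g.fst) at hdiv
    change pull B X.iso.inv (unit f.fst) = pull B X.iso.inv (unit g.fst) at hu
    have e1 : baseMap f.fst = (X.iso.hom ≫ T.map f.snd) ≫ Y.iso.inv := (Iso.eq_comp_inv Y.iso).mpr f.w
    have e2 : baseMap g.fst = (X.iso.hom ≫ T.map g.snd) ≫ Y.iso.inv := (Iso.eq_comp_inv Y.iso).mpr g.w
    apply CFP.hom_ext
    · apply ModelFrobenioid.hom_ext
      · exact hd
      · rw [e1, e2, hb]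
      · exact fpPull_inv_injective X.iso hdiv
      · exact fpPull_inv_injective X.iso hu
    · exact hb⟩
  -- full
  haveI : Fwd.Full := ⟨fun {X Y} g => by
    let φ : X.fst ⟶ Y.fst :=
      { degFr := degFr g
        base := (X.iso.hom ≫ T.map (baseMap g :)) ≫ Y.iso.inv
        div := pull Φ X.iso.hom (div g :)
        unit := pull B X.iso.hom (unit g :)
        rel := rel_transport_hom Φ B DivB T X.fst Y.fst X.iso Y.iso (baseMap g :) (degFr g) (div g :) (unit g :)
          (rel g) }
    refine ⟨⟨φ, baseMap g, ?_⟩, ?_⟩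
    · change ((X.iso.hom ≫ T.map (baseMap g :)) ≫ Y.iso.inv) ≫ Y.iso.hom = X.iso.hom ≫ T.map (baseMap g :)
      rw [Category.assoc, Iso.inv_hom_id, Category.comp_id]
    · apply ModelFrobenioid.hom_ext
      · rfl
      · rfl
      · exact fpPull_inv_hom_cancel (Ψ := Φ) X.iso (div g :)
      · exact fpPull_inv_hom_cancel (Ψ := B) X.iso (unit g :)⟩
  -- essentially surjective
  haveI : Fwd.EssSurj := ⟨fun Y => by
    obtain ⟨A', c⟩ := Y
    let X : PreFrobenioid.FiberProduct (toElem Φ B DivB) T := ⟨⟨T.obj A', c⟩, A', Iso.refl _⟩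
    have hX : Fwd.obj X = ⟨A', c⟩ := by
      change (⟨A', pullGp Φ (𝟙 (T.obj A')) c⟩ :
          ModelFrobenioid (T.op ⋙ Φ) (T.op ⋙ B) (Functor.whiskerLeft T.op DivB)) = ⟨A', c⟩
      rw [pullGp_id]
    exact ⟨X, ⟨eqToIso hX⟩⟩⟩
  haveI : Fwd.IsEquivalence := {}
  exact ⟨Fwd.asEquivalence, rfl, rfl⟩

/-- In particular the fibre product is equivalent to the model Frobenioid of the pulled-back data OVER `D′`
(`E ⋙ Base ≅ pr₂`), the form consumed by the `1`-unique-square transports of [FrdI] Cor. 4.11 (ii).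
[cite: MochizukiFrdI2008, Prop. 1.6 p.27] -/
theorem exists_fiberProduct_equivalence_over :
    ∃ E : PreFrobenioid.FiberProduct (toElem Φ B DivB) T ≌
        ModelFrobenioid (T.op ⋙ Φ) (T.op ⋙ B) (Functor.whiskerLeft T.op DivB),
      Nonempty (E.functor ⋙ baseFunctor (T.op ⋙ Φ) (T.op ⋙ B) (Functor.whiskerLeft T.op DivB) ≅
        CFP.proj₂ (PreFrobenioid.baseFunctor (toElem Φ B DivB)) T) := by
  obtain ⟨E, h, -⟩ := exists_fiberProduct_equivalence Φ B DivB T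
  exact ⟨E, ⟨eqToIso h⟩⟩

end ModelFrobenioid

end Literature.AlgebraicGeometry.Frobenioids
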